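import Mathlib
import Summits.NavierStokesRegularity.FluidComputer.OneCopyRestriction

/-!
# Symmetry-class projectors and matrix units of a finite group action
(cap g7, cell `ns-blowup`, 2026-08-26)

HONEST FRAMING (human ruling D-0035): nothing here is a claim about Navier–Stokes blow-up.
WHAT THIS IS NOT: not NS evidence. MODEL/linear bookkeeping — the representation-theoretic
identities behind every CLASS-RESTRICTED certificate of the cell (X0 PAIR W-1, D2-3L-X0, O3′/O3″,
P-ONSET13-3L; engines `skc.py` 7a8f74d2e0b53992 `ClassBasis` and `d2_cert.py` v1.8 58fa176b0c17cc92
`OneCopyBasis`). Those certificates work on the range of a CHARACTER PROJECTOR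

  `P_c = (d_c/|Γ|) ∑_g χ_c(g) ρ(g)`
  (isotypic component `X_c` of the flow's 24-group `Γ ≅ O`, classes I–V),

or, for the 3-dimensional classes IV and V, on the range of the MATRIX UNIT
`p₁₁ = (3/|Γ|) ∑_g r(g⁻¹)₁₁ ρ(g)` («one copy»; `r(g) = M_g` resp. `sgn(g) M_g`). Two sentences
were left to the referee's desk by the P-ONSET13-3L RESULT (STATUS l.4856; refuter2 K-READ
l.4887 (5)):

* (hsum / hcomm) the class projectors SUM TO THE IDENTITY and COMMUTE with the MODEL operator — the
  hypotheses of `LyapunovEigenvalueExclusion.re_eigenvalue_le_of_classwise_generator_form`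
  («all classes certified ⇒ no eigenvalue of the whole operator with `Re λ > ω`»);
* (copy ↔ component) the matrix units intertwine the copies of an isotypic component injectively —
  the hypotheses `hE / hT / hinj / hp / hsum` of
  `OneCopyRestriction.exists_eigenvector_mem_of_intertwiners` («no eigenvalue on copy 1 ⇒ none on
  the component»).

This file proves both from the two FINITE identities that a character table / an irreducible matrix
representation carries, stated as hypotheses on explicit sums (no new definitions):

* (COL) `∑_c κ_c χ_c(g) = [g = 1]` — column orthogonality of the character table at the identity
  column, `κ_c = d_c/|Γ|` — gives `∑_c P_c = 1` (`sum_classProj_eq_one`,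
  `sum_classProj_apply_eq_self`);
* (SCHUR) `κ ∑_g r(g⁻¹)_{βα} r(g)_{εγ} = [α = ε ∧ β = γ]` — Schur orthogonality of the matrix
  coefficients of `r`, `κ = n/|Γ|` — gives the matrix-unit relations
  `p_{αβ} p_{γδ} = [β = γ] p_{αδ}` for `p_{αβ} = κ ∑_g r(g⁻¹)_{βα} ρ(g)` (`matrixUnit_mul`), hence
  `∑_α p_{αα} = κ ∑_g tr r(g⁻¹) ρ(g)` (the character projector, `sum_matrixUnit_diag`) and the
  transfer theorem `exists_eigenvector_mem_range_matrixUnit`;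

everything commutes with any `L` commuting with all `ρ(g)` (`OneCopyRestriction.commute_sum_smul`).
Packaged census forms: `eq_zero_of_classwise` (no eigenvector in any class ⇒ none at all) and
`eq_zero_of_oneCopy` (none on one copy ⇒ none on the isotypic component).

For `Γ ≅ O` both identities are finite integer checks on the 24 proper signed permutation matrices
(sequel file `CubeRotationOrthogonality`: (COL) for skc's `CHAR` table; (SCHUR) `∑_M M_{ab} M_{cd} =
8·δ_{ac} δ_{bd}` for the vector irrep of class IV — class V = sgn ⊗ IV has the same products).

General commutative ring of scalars `R`, any `R`-module `M`, any finite group `G`, representation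
`ρ : G →* Module.End R M`, matrix representation `r : G →* Matrix m m R`; the certificates use
`R = ℂ`. Mathlib + `OneCopyRestriction`; no definitions; std axioms. Nothing here is specific to
Navier–Stokes.
-/

namespace Summit.NavierStokesRegularity.FluidComputer.SymmetryClassProjectors

open Module Module.End

variable {R M : Type*} [CommRing R] [AddCommGroup M] [Module R M]
variable {G : Type*} [Group G] [Fintype G]

/-! ### §1 Character projectors: `∑_c P_c = 1` from (COL); commutation with the commutant -/

section ClassProjectors

variable {ι : Type*} [Fintype ι]

omit [Group G] in
/-- Regrouping by group element: `∑_c κ_c • ∑_g χ_c(g) • ρ g = ∑_g (∑_c κ_c χ_c(g)) • ρ g`. -/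
theorem sum_classProj_eq_sum_col (ρ : G → Module.End R M) (χ : ι → G → R) (κ : ι → R) :
    (∑ c, κ c • ∑ g, χ c g • ρ g) = ∑ g, (∑ c, κ c * χ c g) • ρ g := by
  simp_rw [Finset.smul_sum, smul_smul, Finset.sum_smul]
  exact Finset.sum_comm

/-- **(COL) ⇒ the class projectors sum to the identity.** If the weights `κ_c` and class functions
`χ_c` satisfy the column identity `∑_c κ_c χ_c(g) = [g = 1]` (for a character table:
`κ_c = d_c/|G|`, column orthogonality at the identity), then
`∑_c κ_c ∑_g χ_c(g) ρ(g) = ρ(1) = 1`. -/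
theorem sum_classProj_eq_one [DecidableEq G] (ρ : G →* Module.End R M) (χ : ι → G → R)
    (κ : ι → R)
    (hcol : ∀ g : G, ∑ c, κ c * χ c g = if g = 1 then 1 else 0) :
    (∑ c, κ c • ∑ g, χ c g • ρ g) = 1 := by
  rw [sum_classProj_eq_sum_col]
  simp_rw [hcol, ite_smul, one_smul, zero_smul]
  rw [Finset.sum_ite_eq' Finset.univ (1 : G) (fun g => ρ g)]
  simp

/-- Pointwise form for a family of maps `P c` GIVEN BY the projector formula:
`∑_c P_c v = v` — hypothesis `hsum` of
`LyapunovEigenvalueExclusion.re_eigenvalue_le_of_classwise_generator_form` /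
`OneCopyRestriction.exists_component_eigenvector`. -/
theorem sum_classProj_apply_eq_self [DecidableEq G] (ρ : G →* Module.End R M) (χ : ι → G → R)
    (κ : ι → R)
    (hcol : ∀ g : G, ∑ c, κ c * χ c g = if g = 1 then 1 else 0)
    (P : ι → Module.End R M) (hP : ∀ c, P c = κ c • ∑ g, χ c g • ρ g) (v : M) :
    ∑ c, P c v = v := by
  have h := congrArg (fun T : Module.End R M => T v) (sum_classProj_eq_one ρ χ κ hcol)
  simpa only [← hP, LinearMap.sum_apply, Module.End.one_apply] using h

omit [Group G] in
/-- A class projector (indeed any `κ • ∑_g χ(g) • ρ g`) commutes with every `L` that commutes with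
all `ρ g`. -/
theorem classProj_commute (ρ : G → Module.End R M) (χ : G → R) (κ : R) (L : Module.End R M)
    (hL : ∀ g, Commute (ρ g) L) : Commute (κ • ∑ g, χ g • ρ g) L :=
  (OneCopyRestriction.commute_sum_smul Finset.univ χ ρ L fun g _ => hL g).smul_left κ

omit [Group G] [Fintype ι] in
/-- Pointwise commutation `P_c (L v) = L (P_c v)` — hypothesis `hcomm` of
`LyapunovEigenvalueExclusion.re_eigenvalue_le_of_classwise_generator_form`. -/
theorem classProj_apply_comm (ρ : G → Module.End R M) (χ : ι → G → R) (κ : ι → R)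
    (P : ι → Module.End R M) (hP : ∀ c, P c = κ c • ∑ g, χ c g • ρ g) (L : Module.End R M)
    (hL : ∀ g, Commute (ρ g) L) (c : ι) (v : M) : P c (L v) = L (P c v) := by
  have h := congrArg (fun T : Module.End R M => T v)
    (hP c ▸ classProj_commute ρ (χ c) (κ c) L hL).eq
  simpa only [Module.End.mul_apply] using h

/-- **Class function ⇒ `Γ`-equivariance.** If `χ` is a class function (`χ (h * g * h⁻¹) = χ g`), the
operator `∑_g χ(g) • ρ g` commutes with every `ρ h`; in particular its range is `ρ`-invariant. -/
theorem rep_commute_classSum (ρ : G →* Module.End R M) (χ : G → R)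
    (hχ : ∀ g h : G, χ (h * g * h⁻¹) = χ g) (h : G) :
    Commute (ρ h) (∑ g, χ g • ρ g) := by
  rw [Commute, SemiconjBy, Finset.mul_sum, Finset.sum_mul]
  simp_rw [mul_smul_comm, smul_mul_assoc, ← map_mul]
  -- reindex the left sum by `g ↦ h * g * h⁻¹`, on which `χ` is constant
  refine Fintype.sum_equiv (MulAut.conj h).toEquiv _ _ fun g => ?_
  change χ g • ρ (h * g) = χ (h * g * h⁻¹) • ρ (h * g * h⁻¹ * h)
  rw [hχ, inv_mul_cancel_right]

/-- Under (COL) and `L` commuting with the action, an eigenvector of `L` has a non-zero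
eigen-component in some class: `∃ c, P_c v ≠ 0 ∧ L (P_c v) = μ • P_c v`. -/
theorem exists_classProj_eigenvector [DecidableEq G] (ρ : G →* Module.End R M) (χ : ι → G → R)
    (κ : ι → R)
    (hcol : ∀ g : G, ∑ c, κ c * χ c g = if g = 1 then 1 else 0)
    (P : ι → Module.End R M) (hP : ∀ c, P c = κ c • ∑ g, χ c g • ρ g) (L : Module.End R M)
    (hL : ∀ g, Commute (ρ g) L) {v : M} {μ : R} (hv : L v = μ • v) (hv0 : v ≠ 0) :
    ∃ c, P c v ≠ 0 ∧ L (P c v) = μ • P c v := by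
  obtain ⟨c, -, hc⟩ := OneCopyRestriction.exists_component_eigenvector Finset.univ P L
    (fun c _ => hP c ▸ classProj_commute ρ (χ c) (κ c) L hL)
    (sum_classProj_apply_eq_self ρ χ κ hcol P hP v) hv hv0
  exact ⟨c, hc⟩

/-- **Census form («all classes ⇒ whole space»).** Under (COL), if `L` commutes with the action
and has NO eigenvector for `μ` in the range of any class projector `P_c`, then `L` has no
eigenvector for `μ` at all. -/
theorem eq_zero_of_classwise [DecidableEq G] (ρ : G →* Module.End R M) (χ : ι → G → R)
    (κ : ι → R)
    (hcol : ∀ g : G, ∑ c, κ c * χ c g = if g = 1 then 1 else 0)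
    (P : ι → Module.End R M) (hP : ∀ c, P c = κ c • ∑ g, χ c g • ρ g) (L : Module.End R M)
    (hL : ∀ g, Commute (ρ g) L) (μ : R)
    (hno : ∀ c, ∀ w ∈ LinearMap.range (P c), L w = μ • w → w = 0) (v : M) (hv : L v = μ • v) :
    v = 0 := by
  by_contra hv0
  obtain ⟨c, hc0, hc⟩ := exists_classProj_eigenvector ρ χ κ hcol P hP L hL hv hv0
  exact hc0 (hno c (P c v) ⟨v, rfl⟩ hc)

end ClassProjectors

/-! ### §2 Matrix units from (SCHUR): `p_{αβ} p_{γδ} = [β = γ] p_{αδ}` -/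

section MatrixUnits

variable {m : Type*} [Fintype m] [DecidableEq m]

omit [Fintype m] [DecidableEq m] in
/-- Product of two `ρ`-sums: `(∑_g a(g) ρ g)(∑_h b(h) ρ h) = ∑_u (∑_g a(g) b(g⁻¹ u)) ρ u`
(collect `u = g h`). -/
theorem sum_smul_rep_mul_sum_smul_rep (ρ : G →* Module.End R M) (a b : G → R) :
    (∑ g, a g • ρ g) * (∑ h, b h • ρ h) = ∑ u, (∑ g, a g * b (g⁻¹ * u)) • ρ u := by
  calc (∑ g, a g • ρ g) * (∑ h, b h • ρ h) = ∑ g, ∑ h, (a g * b h) • ρ (g * h) := by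
        rw [Finset.sum_mul]
        refine Finset.sum_congr rfl fun g _ => ?_
        rw [Finset.mul_sum]
        refine Finset.sum_congr rfl fun h _ => ?_
        rw [smul_mul_smul_comm, map_mul]
    _ = ∑ g, ∑ u, (a g * b (g⁻¹ * u)) • ρ u := by
        refine Finset.sum_congr rfl fun g _ => ?_
        exact Fintype.sum_equiv (Equiv.mulLeft g) _ _ fun h => by simp
    _ = ∑ u, (∑ g, a g * b (g⁻¹ * u)) • ρ u := by
        rw [Finset.sum_comm]
        simp_rw [Finset.sum_smul]

/-- The scalar consequence of (SCHUR) used for the product of two matrix units: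
`κ ∑_g r(g⁻¹)_{βα} r(u⁻¹ g)_{δγ} = [β = γ] r(u⁻¹)_{δα}`. -/
theorem schur_coeff (r : G →* Matrix m m R) (κ : R)
    (hS : ∀ α β γ ε : m, κ * ∑ g, r g⁻¹ β α * r g ε γ = if α = ε ∧ β = γ then 1 else 0)
    (α β γ δ : m) (u : G) :
    κ * ∑ g, r g⁻¹ β α * r (u⁻¹ * g) δ γ = if β = γ then r u⁻¹ δ α else 0 := by
  have hmul : ∀ g, r (u⁻¹ * g) δ γ = ∑ ε, r u⁻¹ δ ε * r g ε γ := fun g => by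
    rw [map_mul, Matrix.mul_apply]
  calc κ * ∑ g, r g⁻¹ β α * r (u⁻¹ * g) δ γ
      = κ * ∑ g, ∑ ε, r u⁻¹ δ ε * (r g⁻¹ β α * r g ε γ) := by
        congr 1
        refine Finset.sum_congr rfl fun g _ => ?_
        rw [hmul, Finset.mul_sum]
        exact Finset.sum_congr rfl fun ε _ => by ring
    _ = ∑ ε, r u⁻¹ δ ε * (κ * ∑ g, r g⁻¹ β α * r g ε γ) := by
        rw [Finset.sum_comm, Finset.mul_sum]
        refine Finset.sum_congr rfl fun ε _ => ?_
        rw [Finset.mul_sum, Finset.mul_sum, Finset.mul_sum]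
        exact Finset.sum_congr rfl fun g _ => by ring
    _ = ∑ ε, r u⁻¹ δ ε * (if α = ε ∧ β = γ then 1 else 0) :=
        Finset.sum_congr rfl fun ε _ => by rw [hS]
    _ = if β = γ then r u⁻¹ δ α else 0 := by
        by_cases hβγ : β = γ
        · subst hβγ
          simp [Finset.sum_ite_eq]
        · simp [hβγ]

/-- **(SCHUR) ⇒ the matrix-unit relations.** For `p_{αβ} := κ ∑_g r(g⁻¹)_{βα} ρ(g)`:
`p_{αβ} p_{γδ} = [β = γ] p_{αδ}`. -/
theorem matrixUnit_mul (ρ : G →* Module.End R M) (r : G →* Matrix m m R) (κ : R)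
    (hS : ∀ α β γ ε : m, κ * ∑ g, r g⁻¹ β α * r g ε γ = if α = ε ∧ β = γ then 1 else 0)
    (α β γ δ : m) :
    (κ • ∑ g, r g⁻¹ β α • ρ g) * (κ • ∑ g, r g⁻¹ δ γ • ρ g) =
      if β = γ then κ • ∑ g, r g⁻¹ δ α • ρ g else 0 := by
  rw [smul_mul_smul_comm, sum_smul_rep_mul_sum_smul_rep]
  have hcoef : ∀ u : G,
      κ * ∑ g, r g⁻¹ β α * r (g⁻¹ * u)⁻¹ δ γ = if β = γ then r u⁻¹ δ α else 0 := by
    intro u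
    have hg : ∀ g : G, r (g⁻¹ * u)⁻¹ δ γ = r (u⁻¹ * g) δ γ := fun g => by rw [mul_inv_rev, inv_inv]
    simp_rw [hg]
    exact schur_coeff r κ hS α β γ δ u
  calc (κ * κ) • ∑ u, (∑ g, r g⁻¹ β α * r (g⁻¹ * u)⁻¹ δ γ) • ρ u
      = κ • ∑ u, (κ * ∑ g, r g⁻¹ β α * r (g⁻¹ * u)⁻¹ δ γ) • ρ u := by
        rw [mul_smul]
        congr 1
        rw [Finset.smul_sum]
        refine Finset.sum_congr rfl fun u _ => ?_
        rw [smul_smul]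
    _ = κ • ∑ u, (if β = γ then r u⁻¹ δ α else 0) • ρ u := by simp_rw [hcoef]
    _ = if β = γ then κ • ∑ g, r g⁻¹ δ α • ρ g else 0 := by
        split_ifs <;> simp

/-- Pointwise form of `matrixUnit_mul` for a family `p α β` GIVEN BY the matrix-unit formula. -/
theorem matrixUnit_apply_apply (ρ : G →* Module.End R M) (r : G →* Matrix m m R) (κ : R)
    (hS : ∀ α β γ ε : m, κ * ∑ g, r g⁻¹ β α * r g ε γ = if α = ε ∧ β = γ then 1 else 0)
    (p : m → m → Module.End R M) (hp : ∀ α β, p α β = κ • ∑ g, r g⁻¹ β α • ρ g)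
    (α β γ δ : m) (v : M) :
    p α β (p γ δ v) = if β = γ then p α δ v else 0 := by
  have h := congrArg (fun T : Module.End R M => T v) (matrixUnit_mul ρ r κ hS α β γ δ)
  simp only [Module.End.mul_apply, ← hp α β, ← hp γ δ, ← hp α δ] at h
  rw [h]
  split_ifs <;> simp

omit [DecidableEq m] in
/-- `∑_α p_{αα} = κ ∑_g tr r(g⁻¹) • ρ g`: the diagonal matrix units sum to the character projector
of the class (`χ(g) = tr r(g⁻¹)`; for the real characters of `O`, `tr r(g⁻¹) = tr r(g)`). -/
theorem sum_matrixUnit_diag (ρ : G → Module.End R M) (r : G → Matrix m m R) (κ : R) :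
    (∑ α, κ • ∑ g, r g⁻¹ α α • ρ g) = κ • ∑ g, (r g⁻¹).trace • ρ g := by
  rw [← Finset.smul_sum, Finset.sum_comm]
  congr 1
  refine Finset.sum_congr rfl fun g _ => ?_
  rw [← Finset.sum_smul, Matrix.trace]
  rfl

omit [Fintype m] [DecidableEq m] in
/-- Every matrix unit commutes with any `L` commuting with all `ρ g`. -/
theorem matrixUnit_commute (ρ : G → Module.End R M) (r : G → Matrix m m R) (κ : R)
    (L : Module.End R M) (hL : ∀ g, Commute (ρ g) L) (α β : m) :
    Commute (κ • ∑ g, r g⁻¹ β α • ρ g) L :=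
  classProj_commute ρ (fun g => r g⁻¹ β α) κ L hL

/-- **Transfer to one copy («no eigenvalue on copy `i₀` ⇒ none on the component»).** Under (SCHUR),
with `p α β` the matrix units and `L` commuting with the action: every eigenvector `v` of `L` lying
in the isotypic component (`∑_α p_{αα} v = v`) yields an eigenvector of `L` for the SAME `μ` inside
the range of `p_{i₀ i₀}` (copy `i₀`), namely `p_{i₀ α}(p_{αα} v)` for a suitable `α`. This
discharges the hypotheses `hE / hT / hinj / hp` of
`OneCopyRestriction.exists_eigenvector_mem_of_intertwiners` with `E α = p_{αα}`,
`T α = p_{i₀ α}`. -/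
theorem exists_eigenvector_mem_range_matrixUnit (ρ : G →* Module.End R M) (r : G →* Matrix m m R)
    (κ : R) (hS : ∀ α β γ ε : m, κ * ∑ g, r g⁻¹ β α * r g ε γ = if α = ε ∧ β = γ then 1 else 0)
    (p : m → m → Module.End R M) (hp : ∀ α β, p α β = κ • ∑ g, r g⁻¹ β α • ρ g)
    (L : Module.End R M) (hL : ∀ g, Commute (ρ g) L) (i₀ : m) {v : M}
    (hcomp : ∑ α, p α α v = v) {μ : R} (hv : L v = μ • v) (hv0 : v ≠ 0) :
    ∃ w ∈ LinearMap.range (p i₀ i₀), w ≠ 0 ∧ L w = μ • w := by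
  have hrel := matrixUnit_apply_apply ρ r κ hS p hp
  refine OneCopyRestriction.exists_eigenvector_mem_of_intertwiners Finset.univ (fun α => p α α)
    (fun α => p i₀ α) L (fun α _ => hp α α ▸ matrixUnit_commute ρ r κ L hL α α)
    (fun α _ => hp i₀ α ▸ matrixUnit_commute ρ r κ L hL i₀ α) (fun α _ x hx => ?_)
    (LinearMap.range (p i₀ i₀)) (fun α _ x => ?_) (by simpa using hcomp) hv hv0
  · -- injectivity on copy α: p_{αα} x = p_{α i₀} (p_{i₀ α} (p_{αα} x))
    have h1 : p i₀ α (p α α x) = p i₀ α x := by rw [hrel]; simp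
    have h2 : p α i₀ (p i₀ α x) = p α α x := by rw [hrel]; simp
    rw [← h2, ← h1, hx, map_zero]
  · -- lands in copy i₀: p_{i₀ α} (p_{αα} x) = p_{i₀ i₀} (p_{i₀ α} x)
    have h1 : p i₀ α (p α α x) = p i₀ α x := by rw [hrel]; simp
    have h3 : p i₀ i₀ (p i₀ α x) = p i₀ α x := by rw [hrel]; simp
    exact ⟨p i₀ α x, by rw [h3, h1]⟩

/-- **Census form («one copy ⇒ component»).** Under (SCHUR), if `L` commutes with the action and has
no eigenvector for `μ` in copy `i₀` (the range of `p_{i₀ i₀}`), then it has none in the isotypic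
component `{v | ∑_α p_{αα} v = v}`. -/
theorem eq_zero_of_oneCopy (ρ : G →* Module.End R M) (r : G →* Matrix m m R)
    (κ : R) (hS : ∀ α β γ ε : m, κ * ∑ g, r g⁻¹ β α * r g ε γ = if α = ε ∧ β = γ then 1 else 0)
    (p : m → m → Module.End R M) (hp : ∀ α β, p α β = κ • ∑ g, r g⁻¹ β α • ρ g)
    (L : Module.End R M) (hL : ∀ g, Commute (ρ g) L) (i₀ : m) (μ : R)
    (hno : ∀ w ∈ LinearMap.range (p i₀ i₀), L w = μ • w → w = 0)
    (v : M) (hcomp : ∑ α, p α α v = v) (hv : L v = μ • v) : v = 0 := by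
  by_contra hv0
  obtain ⟨w, hw, hw0, hLw⟩ :=
    exists_eigenvector_mem_range_matrixUnit ρ r κ hS p hp L hL i₀ hcomp hv hv0
  exact hw0 (hno w hw hLw)

end MatrixUnits

end Summit.NavierStokesRegularity.FluidComputer.SymmetryClassProjectors
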